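import Summits.HodgeConjecture.HodgeConjecture.Theorems.VHCAbelianSchemesRoadWeilLineThroughAnchor
import Summits.HodgeConjecture.HodgeConjecture.Theorems.Ring2AbelianAllOneSplitWeilAnchorBlochCarrierDefs
import Summits.HodgeConjecture.HodgeConjecture.Theorems.Ring2BindersAbelianSchemeVHCShadow
import Literature.AlgebraicGeometry.HodgeTheory.BlochSemiregularSpreadOfSubscheme
import Literature.AlgebraicGeometry.HodgeTheory.AlgebraicClassesPullbackDimLEThree
import Literature.AlgebraicGeometry.HodgeTheory.AlgebraicClassesCupDivisorHolds
import Literature.AlgebraicGeometry.HodgeTheory.HardLefschetzNFoldOfPolarizationClass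
import Literature.AlgebraicGeometry.HodgeTheory.WeilTypePeriodPoint
import HarnessLib

/-!
# Road b02 × the André column — THE SHIFTED-DEGREE BLOCH ENGINE: Bloch (7.4) for an l.c.i. subscheme of codimension `p + j` whose class is
# `a·θʲw + b·θ^{p+j}` ∧ Lieberman's `B(A)` ∧ the Weil family through a prescribed split anchor ⟹ the `E`-Weil line of every split structure of the type
# (route-free; every CM field; every shift `0 ≤ j ≤ dim − 2p`)

research route, not a corollary; conditional on HC_CM plus one named minimal statement.

ROUTE-FREE (imports no `Theses` file of road b02). PART AH of the André column (gen 65). The anchor engine of PART AF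
(`VHCAbelianSchemesRoadWeilLineThroughAnchor` §1) carries the Weil class `w ∈ H^{2p}` IN ITS OWN DEGREE: the door's datum has `κ_p = a·w + c·θᵖ`.
Two theorems move the degree: LIEBERMAN — `A(𝒳_s, Θ|)` for every abelian fibre (`Ring2.Binders.standardConjectureA_of_iso_abelianVariety`,
`Ring2.Binders.mem_algebraicClasses_of_lefschetzPowTo_mem`, both fact-free in the tree): `Θ|ʲ ∪ W'| algebraic ⟹ W'| algebraic` when `2p + j ≤ n`; and
BLOCH 1972 Thm. (7.4) with Remark (7.5) for an ARBITRARY local complete intersection (the refereed named fact `BlochSemiregularSpreadOfSubscheme n q`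
with its proved weakening `….of_smul_add`): a Bloch-semiregular l.c.i. `Z₀` of codimension `q` with `[Z₀] = a·z₀ + b·L₀` spreads the algebraicity of
the horizontal class `z` to a neighbourhood of `s₀`, with NO side conditions in other degrees. Feeding Bloch's fact the horizontal class `Θʲ ∪ W'`
(`W'` the global extension of the anchor's Weil class given by the line clause) and `L = Θ^{p+j}`:

* §1 `weilClassesField_le_algebraicClasses_of_lineFamily_of_bloch_of_shiftedCarried` — THE SHIFTED BLOCH ENGINE (family-generic): the binders of the
  anchor engine with the door ∧ `carriedClasses` replaced by `BlochSemiregularSpreadOfSubscheme n (p + j)` ∧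
  `w₀ ∈ blochShiftedCarriedClasses n p j 𝒳_{s₀} Θ|_{s₀}` (`2p + j ≤ n`) ⟹ `W_E(B) ⊗ ℂ ≤ algebraicClasses B.X p`. Mechanism: line clause (`w₀ ↦ W'`);
  `Θʲ ∪ W'` and `Θ^{p+j}` are global, fibrewise rational of type `(p+j, p+j)`, `Θ^{p+j}|` algebraic; Bloch at `s₀`; Hodge-locus/Baire lemma; at `s₁`
  push `Θ|ʲ ∪ W'|` up by `Θ|^{n-2p-j}` (algebraic classes are stable under `L`) and descend by `A(𝒳_{s₁}, Θ|)` (Lieberman); one-class lemma as before.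
* §2 `weilClassesField_le_algebraicClasses_of_throughSplitAnchor_of_bloch_of_shiftedCarriedAtAnchor` — fed by `andre1996_weilLineFamily_throughSplitAnchor`:
  the node `OneSplitWeilAnchorBlochShiftedCarriers R e₀ p j` (companion Defs) with `2p + j ≤ 2pe₀` serves EVERY split target of type `(R, e₀, p)`.
* §3 `andreSplitWeilClasses_of_throughSplitAnchor_of_bloch_of_oneSplitWeilAnchorBlochCarriersAll` — `AndreSplitWeilClasses ⟸ (∀ n q, Bloch (7.4) at (n, q)) ∧
  family fact ∧ OneSplitWeilAnchorBlochCarriersAll`; `cmHodgeHypothesisAt_of_kodaira_of_bloch_…` (with Kodaira, every CM `B`: Lemme 6.3.2 is CorCM's kernel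
  theorem); and the `(8,2)` quartic cell rows `weilClassesField_le_algebraicClasses_quarticSplitEightfold_of_bloch_of_quarticSplitEightfoldAnchorBlochCarrier`
  (`j ≤ 4`: sixfold ∕ fourfold ∕ surface incarnations).

HONEST: Bloch's theorem and the family fact enter BY NAME (refereed theorems in print, not formalised); Lieberman's `B(A)` is a theorem of the tree; every
carrier statement fed to §1–§3 is OPEN (Bloch, Remark (7.5): «wide open»), NOT implied by the Hodge conjecture (it asks for SEMIREGULAR subschemes).
Nothing here says any carrier, Weil class, `HC_CM`, `HC_AV` or HC holds; `HC_CM` does not occur. References: [cite: Bloch1972Semiregularity, Thm. (7.4),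
Remark (7.5) (p. 65)] [cite: BuchweitzFlenner2003, Thm. 5.2 and (8.1)] [cite: Lieberman1968, main theorem] [cite: Kleiman1968AlgebraicCycles, §2 (A(X)),
Appendix Thm. 2A11] [cite: Andre1996Motifs, §6.3 b)–c), proof of Lemme 6.3.3 (pp. 32–33)] [cite: Deligne1982HodgeCycles, §4 proof of Thm. 4.8, Cor. 4.2]
[cite: MoonenZarhin1998WeilClasses, §1] [cite: VoisinHodgeI2002, Thm. 6.25, Rem. 6.27, §7.1.2] [cite: VoisinHodgeII2003, §9.2.4 Prop. 9.20]
[cite: CharlesSchnell2014Notes, Prop. 11.3.11 (proof)] [cite: Andre1992HodgeCM, Théorème].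
-/

noncomputable section

open CategoryTheory CategoryTheory.Limits AlgebraicGeometry Topology MonoidalCategory CartesianMonoidalCategory

namespace Summit.HodgeConjecture.HodgeConjecture.Ring2.SemiregularRepresentatives

-- the cell's namespace repeats the summit name (`Summit.HodgeConjecture.HodgeConjecture…`), as in every `Ring2*` file
set_option linter.dupNamespace false

open Literature.AlgebraicGeometry Literature.AlgebraicGeometry.Motives
open Literature.AlgebraicGeometry.HodgeTheory
open Literature.AlgebraicGeometry.Deligne1982
open Literature.AlgebraicGeometry.VanGeemen1994 (pullbackOne)
open Literature.AlgebraicTopology.SingularHomology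
open Literature.AlgebraicGeometry.Andre1996 (andre1996_weilLineFamily_throughSplitAnchor IsWeilLineAt)
open Literature.AlgebraicGeometry.Milne1999 (IsOfCMType CMHodgeHypothesisAt)
open Summit.HodgeConjecture.HodgeConjecture.WeilTypeLadder (mem_algebraicClasses_of_isOpen_subset_algebraicityLocus)
open Summit.HodgeConjecture.HodgeConjecture.Ring2.AbelianAll (AndreSplitWeilClasses blochShiftedCarriedClasses OneSplitWeilAnchorBlochShiftedCarriers
  OneSplitWeilAnchorBlochCarriersAll QuarticSplitEightfoldAnchorBlochCarrier)
open Summit.HodgeConjecture.HodgeConjecture.Ring2.Binders (mem_algebraicClasses_of_lefschetzPowTo_mem standardConjectureA_of_iso_abelianVariety)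

variable {n p : ℕ}
variable {B : AbelianVariety ℂ} {η : B ⟶ B} {R : Polynomial ℤ} {e₀ : ℕ}
  {e : ProjectiveEmbedding B.X} {a : complexBetti (projectiveSpace e.n ℂ) 2}

/-! ## §0 Two pieces of bookkeeping: Hodge types along `Lʲ` of a `(1,1)` class; `Lⁱ` of an algebraic class is algebraic (degree spelling `lefschetzPowTo`) -/

section Bookkeeping

variable {X : SchemeOver ℂ}

/-- **`Lʲ_κ` raises Hodge types by `(j, j)`** for `κ` of type `(1,1)` on a smooth projective complex `n`-fold (the cup product respects the bigrading:
the tree's `CupPreservesHodgeType`, unconditional via `cupPreservesHodgeType_of_multiplicative_deRham`; iterate `lefschetzPowTo_succ_apply`).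
[cite: VoisinHodgeI2002, §6.2.3 Rem. 6.27 and §7.1.2] -/
theorem isOfHodgeType_lefschetzPowTo_of_one_one (hX : IsSmoothProjective n X) {κ : complexBetti X 2} (hκ : IsOfHodgeType n X 2 1 1 κ) :
    ∀ (j k m : ℕ) (hm : k + 2 * j = m) (r q : ℕ) (c : complexBetti X k),
      IsOfHodgeType n X k r q c → IsOfHodgeType n X m (r + j) (q + j) (lefschetzPowTo κ j k m hm c)
  | 0, k, m, hm, r, q, c, hc => by
    subst hm
    exact hc
  | j + 1, k, m, hm, r, q, c, hc => by
    rw [lefschetzPowTo_succ_apply κ j k (k + 2 * j) m rfl hm (by omega)]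
    exact isOfHodgeType_lefschetzOperator_of_cupPreservesHodgeType
      (cupPreservesHodgeType_of_multiplicative_deRham (fun E _ _ _ ↦ Literature.NumberTheory.Transcendental.exists_deRhamIsoFamily_holds E) hX)
      hκ (k + 2 * j) m (by omega) (r + j) (q + j) _ (isOfHodgeType_lefschetzPowTo_of_one_one hX hκ j k (k + 2 * j) rfl r q c hc)

/-- **`Lⁱ_h` of an algebraic class is algebraic** for `h ∈ N¹ H²` (Voisin II Prop. 9.20, the tree's `lefschetzPow_mem_supportedClasses_of_mem`), in the
`lefschetzPowTo` spelling with the canonical target degree `2l + 2i`. [cite: VoisinHodgeII2003, §9.2.4 Prop. 9.20] [cite: Fulton1998, §19.2 Cor. 19.2] -/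
theorem lefschetzPowTo_mem_supportedClasses_of_mem (hX : IsSmoothProjective n X) {h : complexBetti X 2} (hh : h ∈ algebraicClasses X 1)
    (l : ℕ) {c : complexBetti X (2 * l)} (hc : c ∈ algebraicClasses X l) (i : ℕ) :
    lefschetzPowTo h i (2 * l) (2 * l + 2 * i) rfl c ∈ supportedClasses X (2 * l + 2 * i) (l + i) := by
  rw [lefschetzPowTo_eq_lefschetzPow]
  exact lefschetzPow_mem_supportedClasses_of_mem hX hh l hc i

end Bookkeeping

/-! ## §1 THE SHIFTED BLOCH ENGINE (family-generic; Bloch (7.4) by name, Lieberman in the kernel) -/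

section Engine

variable {𝒳 S : SchemeOver ℂ} {f : 𝒳 ⟶ S}

/-- `(Iso.refl X).hom^* = id` on Betti cohomology (bookkeeping for the model `Iso.refl 𝒳_{s₀}` of Bloch's fact). [folklore] -/
private theorem map_refl_hom_loc (X : SchemeOver ℂ) (k : ℕ) (c : complexBetti X k) :
    complexBetti.map (Iso.refl X).hom k c = c := by
  rw [Iso.refl_hom, complexBetti.map_id]
  rfl

/-- **THE SHIFTED BLOCH ENGINE.** A Weil-type CM datum `(B, η, R, e₀, p)`; a smooth projective family `f : 𝒳 ⟶ S` of relative dimension `n`, embedded in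
`ℙᴺ × S`, over a smooth irreducible quasi-projective base; a global class `Θ` polarising every fibre; the LINE clause from `s₀` to a chart `e₁ : A₁.X ≅ 𝒳_{s₁}`
with `g' : B ⟶ A₁` for a set `𝒲₀` of classes at `s₀`; a non-zero rational `w₀ ∈ 𝒲₀`; a shift `j` with `2p + j ≤ n`; Bloch's theorem (7.4) at `(n, p + j)`
(`BlochSemiregularSpreadOfSubscheme n (p + j)`, BY NAME); and at `s₀` a Bloch-semiregular local complete intersection `Z ⊂ 𝒳_{s₀}` of codimension `p + j` with
`[Z] = a·Θ|ʲw₀ + b·Θ|^{p+j}`, `a ≠ 0` (`w₀ ∈ blochShiftedCarriedClasses n p j 𝒳_{s₀} Θ|_{s₀}`) ⟹ **`W_E(B) ⊗ ℂ ≤ algebraicClasses B.X p`**. Proof: extend `w₀` to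
`W'` (line clause); `Θʲ ∪ W'` and `Θ^{p+j}` are global classes, fibrewise rational of type `(p+j, p+j)`, the latter fibrewise algebraic; Bloch's fact at the model
`Iso.refl 𝒳_{s₀}` makes `(Θʲ ∪ W')|` algebraic on an open `U ∋ s₀`; the Hodge-locus/Baire lemma on every fibre; at `s₁`, `Lⁱ` (`i = n − 2p − j`) keeps it
algebraic and `A(𝒳_{s₁}, Θ|)` — Lieberman's `B(A)` for the abelian fibre `𝒳_{s₁} ≅ A₁.X`, a theorem of the tree — gives `W'|_{s₁}` algebraic; then
`γ = g'^*(e₁^*(W'|_{s₁})) ∈ W_E(B)` is rational, algebraic, non-zero; one-class lemma. [cite: Bloch1972Semiregularity, Thm. (7.4) and Remark (7.5) (p. 65)]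
[cite: Lieberman1968, main theorem] [cite: Kleiman1968AlgebraicCycles, §2 (A(X))] [cite: Deligne1982HodgeCycles, §4 proof of Thm. 4.8]
[cite: CharlesSchnell2014Notes, Prop. 11.3.11 (proof)] [cite: MoonenZarhin1998WeilClasses, §1] -/
theorem weilClassesField_le_algebraicClasses_of_lineFamily_of_bloch_of_shiftedCarried (hB : IsWeilTypeCM B η R e₀ p)
    (hf : IsSmoothProjectiveFamily f n)
    (hemb : ∃ (N : ℕ) (ι : 𝒳 ⟶ projectiveSpace N ℂ ⊗ S), IsClosedImmersion ι.left ∧ ι ≫ snd (projectiveSpace N ℂ) S = f)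
    [IrreducibleSpace S.left] (hsm : AlgebraicGeometry.Smooth S.hom) (hSqp : IsQuasiProjectiveOver S) (Θ : complexBetti 𝒳 2)
    (hΘ : ∀ s : ComplexPoints S, IsPolarizationClass n (fiberOver f s) (complexBetti.map (fiberι f s) 2 Θ))
    {s₀ s₁ : ComplexPoints S} {A₁ : AbelianVariety ℂ} (e₁ : A₁.X ≅ fiberOver f s₁) (g' : B ⟶ A₁)
    {𝒲₀ : Set (complexBetti (fiberOver f s₀) (2 * p))}
    (hline : IsWeilLineAt f n p s₁ s₀ e₁ g' (weilClassesField B η (R.comp (Polynomial.X ^ 2)) (2 * p)) 𝒲₀)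
    {w₀ : complexBetti (fiberOver f s₀) (2 * p)} (hw₀ : w₀ ∈ 𝒲₀) (hw₀Q : IsRationalClass w₀) (hw₀0 : w₀ ≠ 0)
    {j : ℕ} (hj : 2 * p + j ≤ n) (hBl : BlochSemiregularSpreadOfSubscheme n (p + j))
    (hcar : w₀ ∈ blochShiftedCarriedClasses n p j (fiberOver f s₀) (complexBetti.map (fiberι f s₀) 2 Θ)) :
    weilClassesField B η (R.comp (Polynomial.X ^ 2)) (2 * p) ≤ algebraicClasses B.X p := by
  -- the line clause: `w₀` extends to a global class `W'`
  obtain ⟨W', hW', hW's₀, hγW, hγne⟩ := hline w₀ hw₀ hw₀Q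
  -- the total space is quasi-projective (closed in `ℙᴺ × S`)
  have h𝒳qp : IsQuasiProjectiveOver 𝒳 := by
    obtain ⟨N, ι, hι, -⟩ := hemb
    haveI := hι
    exact IsQuasiProjectiveOver.of_isClosedImmersion_projectiveSpace_tensor ι hSqp
  -- the Bloch datum at `s₀`
  obtain ⟨hX₀, d, hdp, ρ, Z, hZ, i, hi, a', b', hreg, hcodim, hsr, hmem, ha', hx⟩ := hcar
  haveI := hZ
  -- fibrewise facts about `Θ`
  have hΘQ : ∀ s : ComplexPoints S, IsRationalClass (complexBetti.map (fiberι f s) 2 Θ) := fun s ↦ (hΘ s).isRationalClass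
  have hΘH : ∀ s : ComplexPoints S, IsOfHodgeType n (fiberOver f s) 2 1 1 (complexBetti.map (fiberι f s) 2 Θ) := fun s ↦
    isOfHodgeType_of_mem_algebraicClasses_of_isSmoothProjective (hf.isSmoothProjective s) 1 (hΘ s).mem_algebraicClasses
  -- the horizontal class `Θʲ ∪ W'` and the fibrewise algebraic class `Θ^{p+j}`
  set W'' : complexBetti 𝒳 (2 * (p + j)) := lefschetzPowTo Θ j (2 * p) (2 * (p + j)) (two_mul_add_two_mul p j) W' with hW''def
  set L : complexBetti 𝒳 (2 * (p + j)) := cupPowTwo Θ (p + j) with hLdef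
  have hresW'' : ∀ s : ComplexPoints S, complexBetti.map (fiberι f s) (2 * (p + j)) W'' =
      lefschetzPowTo (complexBetti.map (fiberι f s) 2 Θ) j (2 * p) (2 * (p + j)) (two_mul_add_two_mul p j)
        (complexBetti.map (fiberι f s) (2 * p) W') := fun s ↦ by
    rw [hW''def]
    exact map_lefschetzPowTo (fiberι f s) Θ j (2 * p) (2 * (p + j)) (two_mul_add_two_mul p j) W'
  have hresL : ∀ s : ComplexPoints S, complexBetti.map (fiberι f s) (2 * (p + j)) L = cupPowTwo (complexBetti.map (fiberι f s) 2 Θ) (p + j) :=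
    fun s ↦ by rw [hLdef]; exact map_cupPowTwo _ Θ (p + j)
  have hW''s : ∀ s : ComplexPoints S, IsRationalClass (complexBetti.map (fiberι f s) (2 * (p + j)) W'') ∧
      IsOfHodgeType n (fiberOver f s) (2 * (p + j)) (p + j) (p + j) (complexBetti.map (fiberι f s) (2 * (p + j)) W'') := fun s ↦ by
    rw [hresW'' s]
    exact ⟨(hΘQ s).lefschetzPowTo j (2 * p) (2 * (p + j)) (two_mul_add_two_mul p j) (hW' s).1,
      isOfHodgeType_lefschetzPowTo_of_one_one (hf.isSmoothProjective s) (hΘH s) j (2 * p) (2 * (p + j)) (two_mul_add_two_mul p j) p p _ (hW' s).2⟩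
  have hLs : ∀ s : ComplexPoints S, IsRationalClass (complexBetti.map (fiberι f s) (2 * (p + j)) L) ∧
      IsOfHodgeType n (fiberOver f s) (2 * (p + j)) (p + j) (p + j) (complexBetti.map (fiberι f s) (2 * (p + j)) L) := fun s ↦ by
    rw [hresL s]
    exact ⟨(hΘQ s).cupPowTwo (p + j), isOfHodgeType_cupPowTwo (hf.isSmoothProjective s) (hΘH s) (p + j)⟩
  have hLalg : ∀ s : ComplexPoints S, complexBetti.map (fiberι f s) (2 * (p + j)) L ∈ algebraicClasses (fiberOver f s) (p + j) := fun s ↦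
    divisorClassesSpan_le_algebraicClasses_of_isSmoothProjective (hf.isSmoothProjective s) (p + j)
      (by simpa only [one_smul] using smul_cupPowTwo_map_mem_divisorClassesSpan Θ s (hΘQ s) (hΘH s) 1 (p + j))
  -- the class equation at `s₀`, read at the model `Iso.refl 𝒳_{s₀}`
  have hx' : (a' : ℂ) • complexBetti.map (Iso.refl (fiberOver f s₀)).hom (2 * (p + j)) (complexBetti.map (fiberι f s₀) (2 * (p + j)) W'') +
      (b' : ℂ) • complexBetti.map (Iso.refl (fiberOver f s₀)).hom (2 * (p + j)) (complexBetti.map (fiberι f s₀) (2 * (p + j)) L) =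
      subschemeClass hX₀ hdp ρ i hi := by
    rw [map_refl_hom_loc, map_refl_hom_loc, hresW'' s₀, hresL s₀, hW's₀]
    exact hx
  -- LOCAL: Bloch (7.4) with Remark (7.5) at `s₀`
  obtain ⟨U, hUo, hs₀U, hUalg⟩ := BlochSemiregularSpreadOfSubscheme.of_smul_add hBl (fiberOver f s₀) Z i f s₀ (Iso.refl _) W'' L a' b' ha'
    hX₀ d hdp ρ hi hreg hcodim hsr hmem hf h𝒳qp hSqp hsm hW''s hLs hLalg hx'
  -- GLOBAL from LOCAL: the Hodge-locus / Baire lemma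
  have hall := mem_algebraicClasses_of_isOpen_subset_algebraicityLocus f h𝒳qp hSqp hsm hf W'' hUo ⟨s₀, hs₀U⟩ hUalg
  -- at `s₁`: `Θ|ʲ ∪ W'|` is algebraic; push up by `Lⁱ` (`2p + j + i = n`) and descend by `A(𝒳_{s₁}, Θ|)` (Lieberman)
  obtain ⟨k, hk⟩ : ∃ k : ℕ, 2 * p + j + k = n := ⟨n - (2 * p + j), by omega⟩
  set θ₁ : complexBetti (fiberOver f s₁) 2 := complexBetti.map (fiberι f s₁) 2 Θ with hθ₁def
  set w₁ : complexBetti (fiberOver f s₁) (2 * p) := complexBetti.map (fiberι f s₁) (2 * p) W' with hw₁def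
  have h1 : lefschetzPowTo θ₁ j (2 * p) (2 * (p + j)) (two_mul_add_two_mul p j) w₁ ∈ algebraicClasses (fiberOver f s₁) (p + j) := by
    rw [hθ₁def, hw₁def, ← hresW'' s₁]
    exact hall s₁
  have h2 : lefschetzPowTo θ₁ k (2 * (p + j)) (2 * (p + j) + 2 * k) rfl
      (lefschetzPowTo θ₁ j (2 * p) (2 * (p + j)) (two_mul_add_two_mul p j) w₁) ∈
      supportedClasses (fiberOver f s₁) (2 * (p + j) + 2 * k) (p + j + k) :=
    lefschetzPowTo_mem_supportedClasses_of_mem (hf.isSmoothProjective s₁) (hΘ s₁).mem_algebraicClasses (p + j) h1 k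
  rw [lefschetzPowTo_lefschetzPowTo θ₁ k (two_mul_add_two_mul p j) rfl (by omega) w₁] at h2
  have hA₁dim : A₁.dim = n := schemeDim_eq_holds ((hf.isSmoothProjective s₁).of_iso e₁.symm)
  have hw₁alg : w₁ ∈ algebraicClasses (fiberOver f s₁) p :=
    mem_algebraicClasses_of_lefschetzPowTo_mem (standardConjectureA_of_iso_abelianVariety (hf.isSmoothProjective s₁) hA₁dim e₁ (hΘ s₁))
      (show 2 * p + (j + k) = n by omega) (show 2 * p + 2 * (j + k) = 2 * (p + j) + 2 * k by omega) (show p + (j + k) = p + j + k by omega) w₁ h2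
  -- a non-zero rational algebraic class of the `E`-line of `B`
  have hγalg : complexBetti.map g'.hom.hom.hom (2 * p) (complexBetti.map e₁.hom (2 * p) (complexBetti.map (fiberι f s₁) (2 * p) W')) ∈
      algebraicClasses B.X p :=
    map_mem_algebraicClasses_of_abelianVariety AbelianVariety.isSmoothProjective_holds A₁ g'.hom.hom.hom
      ((mem_algebraicClasses_map_iff_of_iso e₁).2 hw₁alg)
  have hγQ : IsRationalClass
      (complexBetti.map g'.hom.hom.hom (2 * p) (complexBetti.map e₁.hom (2 * p) (complexBetti.map (fiberι f s₁) (2 * p) W'))) :=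
    ((hW' s₁).1.pullback _).pullback _
  have her : 2 * e₀ * (2 * p) = 2 * B.dim := by rw [hB.dim_eq]; ring
  exact weilClassesField_le_algebraicClasses_of_isRationalClass_of_ne_zero hB.natDegree_comp hB.irreducible hB.eval₂_eq_zero her hB.k_pos hγW hγQ
    (hγne hw₀0) hγalg

end Engine

/-! ## §2 Fed by the family fact: one shifted Bloch carrier at a prescribed split anchor serves every split target of the same type -/

section ThroughAnchor

variable {X₀ : AbelianVariety ℂ} {η₀ : X₀ ⟶ X₀} {e' : ProjectiveEmbedding X₀.X} {a' : complexBetti (projectiveSpace e'.n ℂ) 2}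

/-- **ONE SHIFTED BLOCH CARRIER AT ONE SPLIT ANCHOR ⟹ THE `E`-WEIL LINE OF EVERY SPLIT STRUCTURE OF THE SAME TYPE.** Bloch (7.4) at `(dim X₀, p + j)`; the
family fact `andre1996_weilLineFamily_throughSplitAnchor`; a split `E`-Weil anchor `(X₀, η₀, e', a')` of type `(R, e₀, p)`, `p > 1`, `2p + j ≤ dim X₀`; and AT
EVERY CHART `(X, ε : X₀.X ≅ X, θ)` of `(X₀, ℚˣ·e'^*a')` with `θ` a polarisation class, SOME non-zero rational class `w` on `X` with `ε^*w` in the `E`-Weil line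
of `(X₀, η₀)` carried in degree `2(p + j)` by a Bloch-semiregular l.c.i. (`w ∈ blochShiftedCarriedClasses (dim X₀) p j X θ`) ⟹ for EVERY split target
`(B, η, e, a)` of type `(R, e₀, p)`: `W_E(B) ⊗ ℂ ≤ algebraicClasses B.X p`. NO door hypothesis other than Bloch's refereed theorem; NO CM hypothesis; `HC_CM`
absent. [cite: Bloch1972Semiregularity, Thm. (7.4) and Remark (7.5) (p. 65)] [cite: Andre1996Motifs, proof of Lemme 6.3.3 (p. 33)]
[cite: Deligne1982HodgeCycles, §4 proof of Thm. 4.8 (clauses (a)–(c))] [cite: Lieberman1968, main theorem] [cite: MoonenZarhin1998WeilClasses, §1] -/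
theorem weilClassesField_le_algebraicClasses_of_throughSplitAnchor_of_bloch_of_shiftedCarriedAtAnchor (h : andre1996_weilLineFamily_throughSplitAnchor)
    {j : ℕ} (hBl : BlochSemiregularSpreadOfSubscheme X₀.dim (p + j)) (hj : 2 * p + j ≤ X₀.dim) (hp : 1 < p) (hX₀ : IsWeilTypeCM X₀ η₀ R e₀ p)
    (ha' : IsRationalClass a') (ha'₀ : a' ≠ 0)
    (hRos₀ : ∀ x y : complexBetti X₀.X 1,
      polarizationPairingOne X₀.X (complexBetti.map e'.ι 2 a') (X₀.dim - 1) (pullbackOne X₀ η₀ x) y =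
        -polarizationPairingOne X₀.X (complexBetti.map e'.ι 2 a') (X₀.dim - 1) x (pullbackOne X₀ η₀ y))
    (hsplit₀ : IsHyperbolicWeilType X₀ η₀ (p * e₀) (complexBetti.map e'.ι 2 a'))
    (hcar : ∀ (X : SchemeOver ℂ) (ε : X₀.X ≅ X) (θ : complexBetti X 2) (c : ℚ), c ≠ 0 →
      complexBetti.map ε.hom 2 θ = (c : ℂ) • complexBetti.map e'.ι 2 a' → IsPolarizationClass X₀.dim X θ →
      ∃ w : complexBetti X (2 * p), IsRationalClass w ∧ w ≠ 0 ∧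
        complexBetti.map ε.hom (2 * p) w ∈ weilClassesField X₀ η₀ (R.comp (Polynomial.X ^ 2)) (2 * p) ∧
        w ∈ blochShiftedCarriedClasses X₀.dim p j X θ)
    (hB : IsWeilTypeCM B η R e₀ p) (ha : IsRationalClass a) (ha₀ : a ≠ 0)
    (hRos : ∀ x y : complexBetti B.X 1,
      polarizationPairingOne B.X (complexBetti.map e.ι 2 a) (B.dim - 1) (pullbackOne B η x) y =
        -polarizationPairingOne B.X (complexBetti.map e.ι 2 a) (B.dim - 1) x (pullbackOne B η y))
    (hsplit : IsHyperbolicWeilType B η (p * e₀) (complexBetti.map e.ι 2 a)) :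
    weilClassesField B η (R.comp (Polynomial.X ^ 2)) (2 * p) ≤ algebraicClasses B.X p := by
  obtain ⟨𝒳, S, f, s₀, s₁, e₀', Θ, c, A₁, e₁, g', hf, hemb, hirr, hsm, hSqp, hΘ, hc, hΘ₀, hline⟩ :=
    h R e₀ p hp X₀ η₀ e' a' hX₀ ha' ha'₀ hRos₀ hsplit₀ B η e a hB ha ha₀ hRos hsplit
  haveI := hirr
  obtain ⟨w, hwQ, hw0, hwW, hwc⟩ := hcar (fiberOver f s₀) e₀' (complexBetti.map (fiberι f s₀) 2 Θ) c hc hΘ₀ (hΘ s₀)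
  exact weilClassesField_le_algebraicClasses_of_lineFamily_of_bloch_of_shiftedCarried hB hf hemb hsm hSqp Θ hΘ e₁ g' hline hwW hwQ hw0 hj hBl hwc

/-- **The node `OneSplitWeilAnchorBlochShiftedCarriers R e₀ p j` serves every split target of type `(R, e₀, p)`** (`p > 1`, `2p + j ≤ 2pe₀`), granted Bloch
(7.4) at `(2pe₀, p + j)` and the family fact. [cite: Bloch1972Semiregularity, Thm. (7.4) and Remark (7.5) (p. 65)] [cite: Andre1996Motifs, proof of Lemme 6.3.3 (p. 33)]
[cite: Lieberman1968, main theorem] -/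
theorem weilClassesField_le_algebraicClasses_of_split_of_throughSplitAnchor_of_bloch_of_oneSplitWeilAnchorBlochShiftedCarriers
    (h : andre1996_weilLineFamily_throughSplitAnchor) {j : ℕ} (hBl : BlochSemiregularSpreadOfSubscheme (2 * p * e₀) (p + j)) (hj : 2 * p + j ≤ 2 * p * e₀)
    (hnode : OneSplitWeilAnchorBlochShiftedCarriers R e₀ p j) (hp : 1 < p) (hB : IsWeilTypeCM B η R e₀ p) (ha : IsRationalClass a) (ha₀ : a ≠ 0)
    (hRos : ∀ x y : complexBetti B.X 1,
      polarizationPairingOne B.X (complexBetti.map e.ι 2 a) (B.dim - 1) (pullbackOne B η x) y =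
        -polarizationPairingOne B.X (complexBetti.map e.ι 2 a) (B.dim - 1) x (pullbackOne B η y))
    (hsplit : IsHyperbolicWeilType B η (p * e₀) (complexBetti.map e.ι 2 a)) :
    weilClassesField B η (R.comp (Polynomial.X ^ 2)) (2 * p) ≤ algebraicClasses B.X p := by
  obtain ⟨X₀, η₀, e', a', hX₀, ha', ha'₀, hRos₀, hsplit₀, hcar⟩ := hnode
  have hdim : X₀.dim = 2 * p * e₀ := hX₀.dim_eq
  rw [← hdim] at hBl hj
  exact weilClassesField_le_algebraicClasses_of_throughSplitAnchor_of_bloch_of_shiftedCarriedAtAnchor h hBl hj hp hX₀ ha' ha'₀ hRos₀ hsplit₀ hcar hB ha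
    ha₀ hRos hsplit

end ThroughAnchor

/-! ## §3 Rows: `AndreSplitWeilClasses`, the CM hypothesis with Kodaira, and the `(8,2)` quartic cell in its shifted incarnations -/

section Rows

/-- **`AndreSplitWeilClasses ⟸ (Bloch (7.4) at every `(n, q)`) ∧ the family fact ∧ OneSplitWeilAnchorBlochCarriersAll`**: the Weil classes of the split `E`-Weil
structures of EVERY CM field `E`, every `p ≥ 1` (`p = 1` is Lefschetz `(1,1)`), from ONE Bloch-semiregular local complete intersection carrying ONE class, in a
shifted degree of our choice, at ONE split anchor of our choice per inhabited type `(E, p)`, `p ≥ 2`. NO `𝒪`-door; NO CM hypothesis; `HC_CM` absent.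
[cite: Bloch1972Semiregularity, Thm. (7.4) and Remark (7.5) (p. 65)] [cite: Andre1996Motifs, §6.3 b)–c) (pp. 32–33)] [cite: Deligne1982HodgeCycles, §4 proof of Thm. 4.8]
[cite: MoonenZarhin1998WeilClasses, §1] [cite: Lieberman1968, main theorem] -/
theorem andreSplitWeilClasses_of_throughSplitAnchor_of_bloch_of_oneSplitWeilAnchorBlochCarriersAll (h : andre1996_weilLineFamily_throughSplitAnchor)
    (hBl : ∀ n q : ℕ, BlochSemiregularSpreadOfSubscheme n q) (hall : OneSplitWeilAnchorBlochCarriersAll) : AndreSplitWeilClasses := by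
  intro B η R e₀ p e a hB ha ha₀ hRos hsplit w hw hwQ
  obtain _ | _ | p := p
  · exact absurd hB.k_pos (lt_irrefl 0)
  · exact lefschetzOneOne_rational_holds hB.isSmoothProjective w hwQ
      (hB.isOfHodgeType_of_mem_weilClassesField MoonenZarhin1998_weilClasses_hodgeCriterion_holds hw)
  · obtain ⟨j, hj, hnode⟩ := hall R e₀ (p + 2) (by omega) B η e a hB ha ha₀ hRos hsplit
    exact weilClassesField_le_algebraicClasses_of_split_of_throughSplitAnchor_of_bloch_of_oneSplitWeilAnchorBlochShiftedCarriers h (hBl _ _) hj hnode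
      (by omega) hB ha ha₀ hRos hsplit hw

/-- **`CMHodgeHypothesisAt B ⟸ Kodaira ∧ (Bloch (7.4) at every `(n, q)`) ∧ the family fact ∧ OneSplitWeilAnchorBlochCarriersAll`** for every `B`: the Hodge
classes of every CM abelian variety are algebraic (André's CM reduction, Lemme 6.3.2 = André 1992, is CorCM's KERNEL theorem; Kodaira turns its polarization classes
into hyperplane classes; codimension `≤ 1` is Lefschetz). This is `HC_CM` read pointwise, from Bloch's door. [cite: Andre1992HodgeCM, Théorème]
[cite: Andre1996Motifs, §6.3 Lemmes 6.3.2–6.3.3 (pp. 32–33)] [cite: Bloch1972Semiregularity, Thm. (7.4) and Remark (7.5) (p. 65)] [cite: Huybrechts2005, Prop. 5.3.1, Cor. 5.3.3] -/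
theorem cmHodgeHypothesisAt_of_kodaira_of_bloch_of_oneSplitWeilAnchorBlochCarriersAll (hK : Kodaira1954_rationalKaehlerClass_eq_hyperplaneClass)
    (h : andre1996_weilLineFamily_throughSplitAnchor) (hBl : ∀ n q : ℕ, BlochSemiregularSpreadOfSubscheme n q) (hall : OneSplitWeilAnchorBlochCarriersAll)
    (B : AbelianVariety ℂ) : CMHodgeHypothesisAt B :=
  cmHodgeHypothesisAt_of_kodaira_of_andreSplitWeilClasses hK (andreSplitWeilClasses_of_throughSplitAnchor_of_bloch_of_oneSplitWeilAnchorBlochCarriersAll h hBl hall) B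

/-- **THE `(8,2)` QUARTIC CELL, SHIFTED: Bloch (7.4) at `(8, 2 + j)` ∧ the family fact ∧ `QuarticSplitEightfoldAnchorBlochCarrier j` (`j ≤ 4`) ⟹ the
codimension-2 `E`-Weil classes of EVERY split Weil EIGHTFOLD with multiplication by a QUARTIC CM field are algebraic.** `j = 0`: a semiregular l.c.i. sixfold of
class `a·w + b·θ²` on one anchor; `j = 2`: a semiregular l.c.i. fourfold of class `a·θ²w + b·θ⁴`; `j = 4`: a semiregular l.c.i. SURFACE of class `a·θ⁴w + b·θ⁶`.
[cite: Bloch1972Semiregularity, Thm. (7.4) and Remark (7.5) (p. 65)] [cite: Markman2025SecantRealMultiplication, §1.1] [cite: Andre1996Motifs, proof of Lemme 6.3.3 (p. 33)]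
[cite: Lieberman1968, main theorem] -/
theorem weilClassesField_le_algebraicClasses_quarticSplitEightfold_of_bloch_of_quarticSplitEightfoldAnchorBlochCarrier
    (h : andre1996_weilLineFamily_throughSplitAnchor) {j : ℕ} (hj : j ≤ 4) (hBl : BlochSemiregularSpreadOfSubscheme 8 (2 + j))
    (hcell : QuarticSplitEightfoldAnchorBlochCarrier j) (hB : IsWeilTypeCM B η R 2 2) (ha : IsRationalClass a) (ha₀ : a ≠ 0)
    (hRos : ∀ x y : complexBetti B.X 1,
      polarizationPairingOne B.X (complexBetti.map e.ι 2 a) (B.dim - 1) (pullbackOne B η x) y =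
        -polarizationPairingOne B.X (complexBetti.map e.ι 2 a) (B.dim - 1) x (pullbackOne B η y))
    (hsplit : IsHyperbolicWeilType B η (2 * 2) (complexBetti.map e.ι 2 a)) :
    weilClassesField B η (R.comp (Polynomial.X ^ 2)) (2 * 2) ≤ algebraicClasses B.X 2 :=
  weilClassesField_le_algebraicClasses_of_split_of_throughSplitAnchor_of_bloch_of_oneSplitWeilAnchorBlochShiftedCarriers h
    (show BlochSemiregularSpreadOfSubscheme (2 * 2 * 2) (2 + j) from hBl) (by omega) (hcell R B η e a hB ha ha₀ hRos hsplit) (by omega) hB ha ha₀ hRos hsplit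

/-- **Lattice: the unshifted Bloch node IS PART AF's chart node at Bloch's door read class-wise** — `OneSplitWeilAnchorBlochShiftedCarriers R e₀ p 0` needs no
Lieberman at all (`L⁰ = id`): recorded as the `j = 0` instance of §2 with `2p ≤ 2pe₀` automatic for `e₀ ≥ 1`. [cite: Bloch1972Semiregularity, Remark (7.5) (p. 65)] -/
theorem weilClassesField_le_algebraicClasses_of_split_of_throughSplitAnchor_of_bloch_of_unshifted (h : andre1996_weilLineFamily_throughSplitAnchor)
    (hBl : BlochSemiregularSpreadOfSubscheme (2 * p * e₀) p) (hnode : OneSplitWeilAnchorBlochShiftedCarriers R e₀ p 0) (hp : 1 < p)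
    (hB : IsWeilTypeCM B η R e₀ p) (ha : IsRationalClass a) (ha₀ : a ≠ 0)
    (hRos : ∀ x y : complexBetti B.X 1,
      polarizationPairingOne B.X (complexBetti.map e.ι 2 a) (B.dim - 1) (pullbackOne B η x) y =
        -polarizationPairingOne B.X (complexBetti.map e.ι 2 a) (B.dim - 1) x (pullbackOne B η y))
    (hsplit : IsHyperbolicWeilType B η (p * e₀) (complexBetti.map e.ι 2 a)) :
    weilClassesField B η (R.comp (Polynomial.X ^ 2)) (2 * p) ≤ algebraicClasses B.X p := by
  have he₀ : 1 ≤ e₀ := hB.e₀_pos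
  exact weilClassesField_le_algebraicClasses_of_split_of_throughSplitAnchor_of_bloch_of_oneSplitWeilAnchorBlochShiftedCarriers h
    (show BlochSemiregularSpreadOfSubscheme (2 * p * e₀) (p + 0) by simpa only [add_zero] using hBl) (by nlinarith) hnode hp hB ha ha₀ hRos hsplit

end Rows

end Summit.HodgeConjecture.HodgeConjecture.Ring2.SemiregularRepresentatives

end
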